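import Summits.QuantumFields.YangMills.Theorems.IR.VacuumEscapeDefs
import Summits.QuantumFields.YangMills.Theorems.IR.VacuumEscapeCheegerSpectral
import Summits.QuantumFields.YangMills.Theorems.IR.VacuumEscapeCheegerGroundState
import Summits.QuantumFields.YangMills.Theorems.IR.VacuumEscapeCheegerJentzsch
import Literature.MathematicalPhysics.QuantumFieldTheory.WilsonTorusTransferMatrix
import HarnessLib

/-!
# Crux `IR` (stmt-QuantumFields-19354), line `vacuum_escape`: the CHEEGER SEAM PROVED —
`stub_cheeger_proved : ∀ G r a, (∀ β, 0 < a β) → SliceConductanceInUnits G r a → SliceGapInUnits G r a`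

Helper module for item `stmt-QuantumFields-19354` (`--supports … --as helper`): the registered stub `VacuumEscape.stub_cheeger` of the skeleton
`Cruxes/IR/Lines/vacuum_escape.lean` (statement = tree constants of `Theorems/IR/VacuumEscapeDefs.lean`, p590997) closes by
`exact stub_cheeger_proved`.

**Proof** (Osterwalder–Seiler transfer matrix + Perron–Frobenius–Jentzsch + Lawler–Sokal), per coupling `β ≥ 0` and spatial torus `(2S+1)³`:
Lüscher's transfer matrix `𝕋` of the slice kernel `K_β` (tree `WilsonTorusTransferMatrix`: self-adjoint, compact, positive, positivity
improving, eigenbasis `𝕋 bᵢ = λᵢ bᵢ`, `0 ≤ λᵢ ≤ λ_{i₀} = ‖𝕋‖`, `Z((m+2) × N³) = Σ λᵢ^{m+2}`) has a bounded pointwise ground state `h ≥ h₀ > 0`,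
`b_{i₀} = ±h`, gap `λᵢ ≤ θ < λ₀` (part 3, `exists_groundState_data`); the slice-chain probabilities are spectral sums (part 1,
`hasSum_cyclic_insert_fg`): `mass_m(A) = Σ rᵢ^{m+2} πᵢ(A) / Σ rᵢ^{m+2}`, `stay_m(A) = λ₀⁻¹ Σ rᵢ^{m+1} qᵢ(A) / Σ rᵢ^{m+2}`, `rᵢ = λᵢ/λ₀`, so
`mass_m(A) → ∫_A h²`, `stay_m(A) → λ₀⁻¹ ∫_A ∫_A hK_βh` (`tendsto_tsum_pow_mul`); the hypothesis `k·mass(1 − mass) ≤ mass − stay` eventually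
in `m` passes to the limit and is the setwise conductance bound of the ground-state chain; part 2 (`eigenvalue_le_of_conductance`, Lawler–Sokal
Thm 2.1 via the tree's `cheeger_variance_le_dirichletForm`) gives `λᵢ ≤ λ₀(1 − k²/8)` for `i ≠ i₀`, whence
`x_t = Σ_{i ≠ i₀} rᵢ^t ≤ x₂ (1 − k²/8)₊^{t−2} ≤ x₂ e^{k²/4} e^{−(k²/8) t}` with `k = c√(a β)`, i.e. `SliceGapInUnits` with `c₁ = c²/8`.

HONEST FRAMING: a seam between two currencies of ONE line of an OPEN gap-crux; the line's load `stub_noStickySliceEvent` (conductance at weak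
coupling) is untouched; nothing here proves weak-coupling mixing or the YM mass gap (Clay); `R4` closes only the conditional rung `BalabanLadder.UV`.
Refs: G. F. Lawler, A. D. Sokal, Trans. AMS 309 (1988) 557, Thm 2.1; K. Osterwalder, E. Seiler, Ann. Phys. 110 (1978) 440 §§2–3; M. Lüscher, CMP 54
(1977) 283; Reed–Simon IV Thm XIII.43–44; tree files named above.
-/

set_option autoImplicit false

noncomputable section

open MeasureTheory Filter Set Function
open scoped RealInnerProductSpace ENNReal Topology
open Literature.Analysis.OperatorTheory Literature.MathematicalPhysics.QuantumFieldTheory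
open Summit.QuantumFields.YangMills.Cruxes.IR.VacuumEscape.Spectral Summit.QuantumFields.YangMills.Cruxes.IR.VacuumEscape.GroundState

namespace Summit.QuantumFields.YangMills.Cruxes.IR.VacuumEscape

section PerTorus

variable {G : Type} [Group G] [TopologicalSpace G] [IsTopologicalGroup G] [CompactSpace G] [MeasurableSpace G] [BorelSpace G]
  [SecondCountableTopology G] {n : ℕ} {ρ : G →* Matrix (Fin n) (Fin n) ℂ}

omit [SecondCountableTopology G] in
/-- `cyclicExpectation` unfolded on the `Fin`-indexed cycle (`ZMod (m+2) = Fin (m+2)`). -/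
theorem cyclicExpectation_eq (β : ℝ) (N m : ℕ) [NeZero N] (F : (ZMod (m + 2) → GaugeConfig 3 N G) → ℝ) :
    cyclicExpectation ρ β N (m + 2) F =
      (∫ V : Fin (m + 2) → GaugeConfig 3 N G, (∏ t, wilsonSliceKernel ρ β (V t) (V (t + 1))) * F V
          ∂(Measure.pi fun _ => Measure.pi fun _ : Edge 3 N => haarProbability G)) /
        cyclicPartition ρ β N (m + 2) := rfl

omit [IsTopologicalGroup G] [CompactSpace G] [BorelSpace G] [SecondCountableTopology G] in
/-- Normalising a ratio of spectral sums by the top eigenvalue (same power). -/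
theorem ratio_eq_of_hasSum {ι : Type*} {lam r c : ι → ℝ} {lam₀ : ℝ} (hL0 : lam₀ ≠ 0) (hr : ∀ i, lam i = lam₀ * r i)
    (j : ℕ) {Nu De : ℝ} (hN : HasSum (fun i => lam i ^ j * c i) Nu) (hD : HasSum (fun i => lam i ^ j) De) :
    Nu / De = (∑' i, r i ^ j * c i) / (∑' i, r i ^ j) := by
  have hp : lam₀ ^ j ≠ 0 := pow_ne_zero _ hL0
  have h1 : HasSum (fun i => r i ^ j * c i) (Nu / lam₀ ^ j) := by
    refine (hN.div_const (lam₀ ^ j)).congr_fun fun i => ?_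
    rw [hr i, mul_pow]; field_simp
  have h2 : HasSum (fun i => r i ^ j) (De / lam₀ ^ j) := by
    refine (hD.div_const (lam₀ ^ j)).congr_fun fun i => ?_
    rw [hr i, mul_pow]; field_simp
  rw [h1.tsum_eq, h2.tsum_eq, div_div_div_cancel_right₀ hp]

omit [IsTopologicalGroup G] [CompactSpace G] [BorelSpace G] [SecondCountableTopology G] in
/-- Normalising a ratio of spectral sums by the top eigenvalue (numerator one power short). -/
theorem ratio_eq_of_hasSum_succ {ι : Type*} {lam r c : ι → ℝ} {lam₀ : ℝ} (hL0 : lam₀ ≠ 0) (hr : ∀ i, lam i = lam₀ * r i)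
    (j : ℕ) {Nu De : ℝ} (hN : HasSum (fun i => lam i ^ j * c i) Nu) (hD : HasSum (fun i => lam i ^ (j + 1)) De) :
    Nu / De = lam₀⁻¹ * ((∑' i, r i ^ j * c i) / (∑' i, r i ^ (j + 1))) := by
  have hp : lam₀ ^ j ≠ 0 := pow_ne_zero _ hL0
  have hp1 : lam₀ ^ (j + 1) ≠ 0 := pow_ne_zero _ hL0
  have h1 : HasSum (fun i => r i ^ j * c i) (Nu / lam₀ ^ j) := by
    refine (hN.div_const (lam₀ ^ j)).congr_fun fun i => ?_
    rw [hr i, mul_pow]; field_simp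
  have h2 : HasSum (fun i => r i ^ (j + 1)) (De / lam₀ ^ (j + 1)) := by
    refine (hD.div_const (lam₀ ^ (j + 1))).congr_fun fun i => ?_
    rw [hr i, mul_pow]; field_simp
  rw [h1.tsum_eq, h2.tsum_eq]
  field_simp
  ring

/-- **The Cheeger seam on one torus.**  For continuous unitary `ρ`, `β ≥ 0`, a spatial torus `(2S+1)³` and `k ≥ 0`: if every measurable slice
event `A` satisfies `k·mass_m(A)(1 − mass_m(A)) ≤ mass_m(A) − stay_m(A)` for all large temporal extents `m + 2`, then the trace excess of the
cold torus decays at rate `k²/8`: `x_t ≤ K e^{−(k²/8) t}` for all `t ≥ 2`. -/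
theorem traceExcess_le_of_sliceConductance (hρ : Continuous ρ) (hρu : ∀ g, ρ g ∈ Matrix.unitaryGroup (Fin n) ℂ)
    {β : ℝ} (hβ : 0 ≤ β) (S : ℕ) {k : ℝ} (hk : 0 ≤ k)
    (hcond : ∀ A : Set (GaugeConfig 3 (2 * S + 1) G), MeasurableSet A → ∃ m₀ : ℕ, ∀ m : ℕ, m₀ ≤ m →
      k * (sliceMass ρ β (2 * S + 1) (m + 2) A * (1 - sliceMass ρ β (2 * S + 1) (m + 2) A)) ≤
        sliceMass ρ β (2 * S + 1) (m + 2) A - sliceStay ρ β (2 * S + 1) (m + 2) A) :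
    ∃ Kc : ℝ, ∀ m : ℕ, traceExcess ρ β (2 * S + 1) (m + 2) ≤ Kc * Real.exp (-(k ^ 2 / 8 * ((m + 2 : ℕ) : ℝ))) := by
  classical
  set N : ℕ := 2 * S + 1 with hN
  set μ : Measure (GaugeConfig 3 N G) := Measure.pi fun _ : Edge 3 N => haarProbability G with hμ
  set K : GaugeConfig 3 N G → GaugeConfig 3 N G → ℝ := wilsonSliceKernel ρ β with hKdef
  set A := wilsonTorusTransferMatrix ρ β N with hAdef
  -- kernel facts
  have hK : StronglyMeasurable (uncurry K) := stronglyMeasurable_uncurry_wilsonSliceKernel ρ hρ β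
  obtain ⟨C, hC⟩ := exists_norm_wilsonSliceKernel_le (L := N) ρ hρ β
  have hsymm : ∀ x y, K x y = K y x := wilsonSliceKernel_symm ρ hρu β
  have hpos : ∀ x y, 0 < K x y := wilsonSliceKernel_pos ρ hρ β
  obtain ⟨κ₀, hκ₀, hKmin⟩ : ∃ κ₀ : ℝ, 0 < κ₀ ∧ ∀ U U' : GaugeConfig 3 N G, κ₀ ≤ K U U' := by
    have hcont := continuous_uncurry_wilsonSliceKernel (L := N) ρ hρ β
    obtain ⟨p, -, hp⟩ := isCompact_univ.exists_isMinOn univ_nonempty hcont.continuousOn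
    exact ⟨K p.1 p.2, hpos p.1 p.2, fun U U' => (isMinOn_iff.mp hp) (U, U') (mem_univ _)⟩
  have hKnn : ∀ x y, 0 ≤ K x y := fun x y => (hpos x y).le
  have hAker : ∀ φ : Lp ℝ 2 μ, (A φ : GaugeConfig 3 N G → ℝ) =ᵐ[μ] fun U => ∫ U', K U U' * φ U' ∂μ :=
    wilsonTorusTransferMatrix_ae_eq β N hρ
  have hsa : IsSelfAdjoint A := isSelfAdjoint_wilsonTorusTransferMatrix N hρ hρu β
  have hcpt : IsCompactOperator A := isCompactOperator_wilsonTorusTransferMatrix β N hρ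
  have himp : IsPositivityImproving A := isPositivityImproving_wilsonTorusTransferMatrix β N hρ
  have hA0 : A ≠ 0 := wilsonTorusTransferMatrix_ne_zero β N hρ
  -- spectral data and the trace formula
  obtain ⟨s, hs, b, lam, i₀, hb, hle, hL0, hi₀, hS2, hrad, hZ⟩ :=
    exists_spectralData_wilsonTorusTransferMatrix N hρ hρu hβ
  haveI : Countable s := hs
  have hlam0 : ∀ i, 0 ≤ lam i := fun i => (hle i).1
  -- ground-state data
  obtain ⟨h, B, h₀, θ, hhm, hhB, hh₀, hlow, heig, hnorm, ⟨ε, hε2, hbε⟩, horth, hθ0, hθ, hgapl⟩ :=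
    exists_groundState_data (μ := μ) hK hC hsymm hpos hκ₀ hKmin hAker hsa hcpt himp hA0 hb hlam0 hi₀
  -- ratios
  set lam₀ : ℝ := lam i₀ with hlam₀def
  set r : s → ℝ := fun i => lam i / lam₀ with hr
  have hr0 : ∀ i, 0 ≤ r i := fun i => div_nonneg (hlam0 i) hL0.le
  have hri₀ : r i₀ = 1 := div_self hL0.ne'
  set ϑ : ℝ := θ / lam₀ with hϑ
  have hϑ1 : ϑ < 1 := (div_lt_one hL0).2 hθ
  have hrϑ : ∀ i, i ≠ i₀ → r i ≤ ϑ := fun i hi => div_le_div_of_nonneg_right (hgapl i hi) hL0.le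
  have hrsum : Summable fun i => r i ^ 2 := by
    have := hS2.div_const (lam₀ ^ 2)
    refine this.congr fun i => ?_
    rw [hr]; simp only; rw [div_pow]
  have hlam_eq : ∀ i (j : ℕ), lam i ^ j = lam₀ ^ j * r i ^ j := fun i j => by
    rw [← mul_pow, hr]; simp only; rw [mul_div_cancel₀ _ hL0.ne']
  -- STEP 1: the conductance bound of the ground-state chain, set by set
  have hconduct : ∀ Aset : Set (GaugeConfig 3 N G), MeasurableSet Aset →
      k * (∫ x in Aset, h x ^ 2 ∂μ) * (1 - ∫ x in Aset, h x ^ 2 ∂μ) ≤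
        (∫ x in Aset, h x ^ 2 ∂μ) - lam₀⁻¹ * ∫ x in Aset, ∫ y in Aset, h x * K x y * h y ∂μ ∂μ := by
    intro Aset hAset
    obtain ⟨m₀, hm₀⟩ := hcond Aset hAset
    -- the indicator weight and the two insertion operators
    set f : GaugeConfig 3 N G → ℝ := Aset.indicator (fun _ => (1 : ℝ)) with hf
    have hfm : Measurable f := measurable_const.indicator hAset
    have hf01 : ∀ x, f x = 0 ∨ f x = 1 := fun x => by
      by_cases hx : x ∈ Aset
      · right; simp [hf, hx]
      · left; simp [hf, hx]
    have hfb : ∀ x, ‖f x‖ ≤ 1 := fun x => by rcases hf01 x with h0 | h0 <;> simp [h0]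
    have hone : ∀ x : GaugeConfig 3 N G, ‖(fun _ : GaugeConfig 3 N G => (1 : ℝ)) x‖ ≤ 1 := fun x => by simp
    have hX1m := stronglyMeasurable_fgKernel hK hfm (measurable_const : Measurable fun _ : GaugeConfig 3 N G => (1 : ℝ))
    have hX1b := norm_fgKernel_le hC hfb hone
    obtain ⟨X1, hX1⟩ := exists_kernelOp (μ := μ) hX1m hX1b
    have hX2m := stronglyMeasurable_fgKernel hK hfm hfm
    have hX2b := norm_fgKernel_le hC hfb hfb
    obtain ⟨X2, hX2⟩ := exists_kernelOp (μ := μ) hX2m hX2b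
    -- coefficients
    set πc : s → ℝ := fun i => ∫ x, f x * (b i x) ^ 2 ∂μ with hπc
    set qc : s → ℝ := fun i => ⟪b i, X2 (b i)⟫ with hqc
    have hπb : ∀ i, |πc i| ≤ 1 := by
      intro i
      have hsq : Integrable (fun x => (b i x) ^ 2) μ := (Lp.memLp (b i)).integrable_sq
      have h1 : ∫ x, (b i x) ^ 2 ∂μ = 1 := by
        have := inner_eq_integral (μ := μ) (b i) (b i)
        rw [real_inner_self_eq_norm_sq, b.orthonormal.norm_eq_one i, one_pow] at this
        rw [this]; refine integral_congr_ae (Eventually.of_forall fun x => ?_); ring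
      have hnn : 0 ≤ πc i := integral_nonneg fun x => by
        rcases hf01 x with h0 | h0 <;> simp [h0, sq_nonneg]
      have hle1 : πc i ≤ 1 := by
        rw [← h1]
        refine integral_mono_of_nonneg (Eventually.of_forall fun x => ?_) hsq (Eventually.of_forall fun x => ?_)
        · rcases hf01 x with h0 | h0 <;> simp [h0, sq_nonneg]
        · rcases hf01 x with h0 | h0 <;> simp [h0, sq_nonneg]
      rw [abs_of_nonneg hnn]; exact hle1
    have hqb : ∀ i, |qc i| ≤ ‖X2‖ := fun i => by
      calc |qc i| ≤ ‖b i‖ * ‖X2 (b i)‖ := abs_real_inner_le_norm _ _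
        _ ≤ ‖b i‖ * (‖X2‖ * ‖b i‖) := mul_le_mul_of_nonneg_left (X2.le_opNorm _) (norm_nonneg _)
        _ = ‖X2‖ := by rw [b.orthonormal.norm_eq_one i]; ring
    have hlamr : ∀ i, lam i = lam₀ * r i := fun i => by rw [hr]; simp only; rw [mul_div_cancel₀ _ hL0.ne']
    -- the slice-chain probabilities as normalised spectral sums
    have hmass : ∀ M : ℕ, sliceMass ρ β N (M + 1 + 2) Aset =
        (∑' i, r i ^ (M + 1 + 2) * πc i) / (∑' i, r i ^ (M + 1 + 2)) := by
      intro M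
      have hS := hasSum_cyclic_insert_fg (μ := μ) hK hC hsymm hAker hb hfm
        (measurable_const : Measurable fun _ : GaugeConfig 3 N G => (1 : ℝ)) hfb hone hX1 M
      have hcoef : ∀ i, lam i ^ (M + 2) * ⟪b i, X1 (b i)⟫ = lam i ^ (M + 1 + 2) * πc i := by
        intro i
        rw [inner_fgOp_one_eq (μ := μ) hAker hb hX1 i]
        ring
      simp_rw [hcoef, mul_one] at hS
      unfold sliceMass
      rw [cyclicExpectation_eq]
      exact ratio_eq_of_hasSum hL0.ne' hlamr (M + 1 + 2) hS (hZ (M + 1))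
    have hstay : ∀ M : ℕ, sliceStay ρ β N (M + 1 + 2) Aset =
        lam₀⁻¹ * ((∑' i, r i ^ (M + 2) * qc i) / (∑' i, r i ^ (M + 2 + 1))) := by
      intro M
      have hS := hasSum_cyclic_insert_fg (μ := μ) hK hC hsymm hAker hb hfm hfm hfb hfb hX2 M
      unfold sliceStay
      rw [cyclicExpectation_eq]
      exact ratio_eq_of_hasSum_succ hL0.ne' hlamr (M + 2) hS (hZ (M + 1))
    -- the limits `m → ∞`
    have hTπ : Tendsto (fun M : ℕ => ∑' i, r i ^ (M + 1 + 2) * πc i) atTop (𝓝 (πc i₀)) :=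
      (tendsto_tsum_pow_mul hr0 hri₀ hϑ1 hrϑ hrsum hπb).comp (tendsto_add_atTop_nat 1)
    have hT1 : Tendsto (fun M : ℕ => ∑' i, r i ^ (M + 1 + 2)) atTop (𝓝 1) := by
      have h1 := (tendsto_tsum_pow_mul (c := fun _ => (1 : ℝ)) (B := 1) hr0 hri₀ hϑ1 hrϑ hrsum
        (fun _ => by simp)).comp (tendsto_add_atTop_nat 1)
      refine h1.congr fun M => ?_
      simp only [Function.comp_apply, mul_one]
    have hT1' : Tendsto (fun M : ℕ => ∑' i, r i ^ (M + 2 + 1)) atTop (𝓝 1) := hT1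
    have hTq : Tendsto (fun M : ℕ => ∑' i, r i ^ (M + 2) * qc i) atTop (𝓝 (qc i₀)) :=
      tendsto_tsum_pow_mul hr0 hri₀ hϑ1 hrϑ hrsum hqb
    have hTmass : Tendsto (fun M : ℕ => sliceMass ρ β N (M + 1 + 2) Aset) atTop (𝓝 (πc i₀)) := by
      have := hTπ.div hT1 one_ne_zero
      rw [div_one] at this
      exact this.congr fun M => (hmass M).symm
    have hTstay : Tendsto (fun M : ℕ => sliceStay ρ β N (M + 1 + 2) Aset) atTop (𝓝 (lam₀⁻¹ * qc i₀)) := by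
      have := (hTq.div hT1' one_ne_zero).const_mul lam₀⁻¹
      rw [div_one] at this
      exact this.congr fun M => (hstay M).symm
    have hlim : k * (πc i₀ * (1 - πc i₀)) ≤ πc i₀ - lam₀⁻¹ * qc i₀ := by
      refine le_of_tendsto_of_tendsto ((hTmass.mul (tendsto_const_nhds.sub hTmass)).const_mul k) (hTmass.sub hTstay) ?_
      rw [EventuallyLE, eventually_atTop]
      exact ⟨m₀, fun M hM => hm₀ (M + 1) (by omega)⟩
    -- identification of the limits with the ground state
    have hπ₀ : πc i₀ = ∫ x in Aset, h x ^ 2 ∂μ := by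
      have h1 : πc i₀ = ∫ x, f x * h x ^ 2 ∂μ := by
        refine integral_congr_ae ?_
        filter_upwards [hbε] with x hx
        rw [hx, mul_pow, hε2, one_mul]
      rw [h1, ← integral_indicator hAset]
      refine integral_congr_ae (Eventually.of_forall fun x => ?_)
      rcases hf01 x with h0 | h0
      · have hx : x ∉ Aset := by
          intro hx; simp [hf, hx] at h0
        simp [h0, hx]
      · have hx : x ∈ Aset := by
          by_contra hx; simp [hf, hx] at h0
        simp [h0, hx]
    have hq₀ : qc i₀ = ∫ x in Aset, ∫ y in Aset, h x * K x y * h y ∂μ ∂μ := by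
      have h1 : qc i₀ = ∫ x, f x * b i₀ x * ∫ y, K x y * (f y * b i₀ y) ∂μ ∂μ := inner_fgOp_eq (μ := μ) hX2 i₀
      have h2 : ∀ x, ∫ y, K x y * (f y * b i₀ y) ∂μ = ∫ y, K x y * (f y * (ε * h y)) ∂μ := fun x =>
        integral_congr_ae (by filter_upwards [hbε] with y hy; rw [hy])
      rw [h1]
      simp_rw [h2]
      have h3 : ∫ x, f x * b i₀ x * ∫ y, K x y * (f y * (ε * h y)) ∂μ ∂μ =
          ∫ x, f x * (ε * h x) * ∫ y, K x y * (f y * (ε * h y)) ∂μ ∂μ :=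
        integral_congr_ae (by filter_upwards [hbε] with x hx; rw [hx])
      rw [h3, ← integral_indicator hAset]
      refine integral_congr_ae (Eventually.of_forall fun x => ?_)
      have hin : ∫ y, K x y * (f y * (ε * h y)) ∂μ = ε * ∫ y in Aset, K x y * h y ∂μ := by
        rw [← integral_indicator hAset, ← integral_const_mul]
        refine integral_congr_ae (Eventually.of_forall fun y => ?_)
        by_cases hy : y ∈ Aset
        · simp [hf, hy]; ring
        · simp [hf, hy]
      dsimp only
      rw [hin]
      by_cases hx : x ∈ Aset
      · simp only [hf, hx, Set.indicator_of_mem, one_mul]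
        have : ε * h x * (ε * ∫ y in Aset, K x y * h y ∂μ) = ε ^ 2 * (h x * ∫ y in Aset, K x y * h y ∂μ) := by ring
        rw [this, hε2, one_mul, ← integral_const_mul]
        refine integral_congr_ae (Eventually.of_forall fun y => ?_); ring
      · simp [hf, hx]
    rw [hπ₀, hq₀] at hlim
    linarith [hlim]
  -- STEP 2: the excited spectrum
  set u : ℝ := max (1 - k ^ 2 / 8) 0 with hu
  have hu0 : 0 ≤ u := le_max_right _ _
  have hru : ∀ i, i ≠ i₀ → r i ≤ u := by
    intro i hi
    by_cases hli : lam i = 0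
    · rw [hr]; simp only; rw [hli, zero_div]; exact hu0
    · have hlipos : 0 < lam i := lt_of_le_of_ne (hlam0 i) (Ne.symm hli)
      have h1 := eigenvalue_le_of_conductance (μ := μ) hK hC hsymm hKnn hhm hhB hh₀ hlow hL0 heig hnorm hk hconduct hAker
        (hb i) hlipos (b.orthonormal.norm_eq_one i) (horth i hi)
      rw [hr]; simp only
      rw [div_le_iff₀ hL0]
      calc lam i ≤ lam₀ * (1 - k ^ 2 / 8) := h1
        _ ≤ u * lam₀ := by rw [mul_comm]; exact mul_le_mul_of_nonneg_right (le_max_left _ _) hL0.le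
  have huexp : u ≤ Real.exp (-(k ^ 2 / 8)) := by
    refine max_le ?_ (Real.exp_pos _).le
    have := Real.add_one_le_exp (-(k ^ 2 / 8)); linarith
  -- STEP 3: the trace excess as the spectral sum off the top index
  have htr : ∀ m : ℕ, traceExcess ρ β N (m + 2) = ∑' i, (if i = i₀ then 0 else r i ^ (m + 2)) := by
    intro m
    have h1 : HasSum (fun i => r i ^ (m + 2)) (cyclicPartition ρ β N (m + 2) / lam₀ ^ (m + 2)) := by
      have := (hZ m).div_const (lam₀ ^ (m + 2))
      refine this.congr_fun fun i => ?_
      rw [hlam_eq i (m + 2), mul_div_cancel_left₀ _ (pow_ne_zero _ hL0.ne')]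
    have hsumm : Summable fun i => r i ^ (m + 2) := h1.summable
    unfold traceExcess
    rw [hrad, ← h1.tsum_eq, hsumm.tsum_eq_add_tsum_ite i₀, hri₀, one_pow]
    ring
  set x₂ : ℝ := ∑' i, (if i = i₀ then 0 else r i ^ 2) with hx₂
  refine ⟨x₂ * Real.exp (k ^ 2 / 4), fun m => ?_⟩
  rw [htr m]
  have hterm : ∀ i, (if i = i₀ then 0 else r i ^ (m + 2)) ≤ (if i = i₀ then 0 else r i ^ 2) * u ^ m := by
    intro i
    split_ifs with hi
    · simp
    · rw [pow_add, mul_comm]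
      exact mul_le_mul_of_nonneg_left (pow_le_pow_left₀ (hr0 i) (hru i hi) m) (sq_nonneg _)
  have hsum1 : Summable fun i => (if i = i₀ then 0 else r i ^ 2) := by
    refine Summable.of_nonneg_of_le (fun i => ?_) (fun i => ?_) hrsum
    · split_ifs <;> positivity
    · split_ifs <;> [exact sq_nonneg _; exact le_rfl]
  have hsum2 : Summable fun i => (if i = i₀ then 0 else r i ^ (m + 2)) := by
    refine Summable.of_nonneg_of_le (fun i => ?_) hterm (hsum1.mul_right _)
    split_ifs
    · exact le_rfl
    · exact pow_nonneg (hr0 i) _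
  have hx₂0 : 0 ≤ x₂ := tsum_nonneg fun i => by
    split_ifs
    · exact le_rfl
    · exact sq_nonneg _
  calc ∑' i, (if i = i₀ then 0 else r i ^ (m + 2)) ≤ ∑' i, (if i = i₀ then 0 else r i ^ 2) * u ^ m :=
        Summable.tsum_le_tsum hterm hsum2 (hsum1.mul_right _)
    _ = x₂ * u ^ m := tsum_mul_right
    _ ≤ x₂ * Real.exp (-(k ^ 2 / 8)) ^ m := mul_le_mul_of_nonneg_left (pow_le_pow_left₀ hu0 huexp m) hx₂0
    _ = x₂ * Real.exp (k ^ 2 / 4) * Real.exp (-(k ^ 2 / 8 * ((m + 2 : ℕ) : ℝ))) := by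
        rw [← Real.exp_nat_mul, mul_assoc, ← Real.exp_add]
        congr 1; congr 1; push_cast; ring

end PerTorus

/-- **The Cheeger seam PROVED**: one-step conductance in units ⇒ the gap face.  The registered stub `stub_cheeger` of line `vacuum_escape`
closes by `exact stub_cheeger_proved`.  Constant: `c₁ = c²/8` (Lawler–Sokal); `β₂ ↦ max β₂ 0`, `S₁` unchanged, `K = x₂ e^{c² aβ/4}` per
`(β, S)`. -/
theorem stub_cheeger_proved :
    ∀ (G : Type) [Group G] [TopologicalSpace G] [IsTopologicalGroup G] [CompactSpace G]
      [MeasurableSpace G] [BorelSpace G] (r : LatticeRep G) (a : ℝ → ℝ), (∀ β, 0 < a β) →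
      SliceConductanceInUnits G r a → SliceGapInUnits G r a := by
  intro G _ _ _ _ _ _ r a ha hcond
  obtain ⟨c, β₂, S₁, hc, hcond⟩ := hcond
  haveI : SecondCountableTopology G :=
    (r.continuous.isClosedEmbedding r.injective).isEmbedding.secondCountableTopology
  refine ⟨c ^ 2 / 8, max β₂ 0, S₁, by positivity, fun β hβ S hS => ?_⟩
  have hβ0 : 0 ≤ β := le_trans (le_max_right _ _) hβ
  have hβ2 : β₂ ≤ β := le_trans (le_max_left _ _) hβ
  have hk : 0 ≤ c * Real.sqrt (a β) := mul_nonneg hc.le (Real.sqrt_nonneg _)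
  obtain ⟨Kc, hKc⟩ := traceExcess_le_of_sliceConductance (ρ := r.ρ) r.continuous r.mem_unitary hβ0 S hk
    (fun A hA => hcond β hβ2 S hS A hA)
  refine ⟨Kc, fun t ht => ?_⟩
  obtain ⟨m, rfl⟩ : ∃ m, t = m + 2 := ⟨t - 2, by omega⟩
  have hk2 : (c * Real.sqrt (a β)) ^ 2 / 8 = c ^ 2 / 8 * a β := by
    rw [mul_pow, Real.sq_sqrt (ha β).le]; ring
  have := hKc m
  rw [hk2] at this
  simpa [mul_assoc] using this

end Summit.QuantumFields.YangMills.Cruxes.IR.VacuumEscape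

end
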